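import Literature.MathematicalPhysics.QuantumFieldTheory.Balaban1983to89.B15Prop1ChartDeviation
import Literature.MathematicalPhysics.QuantumFieldTheory.Balaban1983to89.T4TreeGaugeTransform

/-!
# `Balaban1983to89.B15Prop1GaugeFixing` — T. Bałaban, *Large field renormalization. I. The basic step of the 𝐑 operation*,
Commun. Math. Phys. **122** (1989) 175–202 [Balaban1989LargeFieldI] («[IV]»), **Proposition 1** p. 194 with its proof
[Balaban1989LargeFieldII] («[LF-II]») p. 359 and the gauge of pp. 195–196: THE GAUGE-FIXING CONTENT of the proof —
*«Fixing the gauge G₀ for V′ we get a small configuration, and we can write V′ = exp iB′»* — AT PRINT'S OBJECTS (the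
Λ-orbits `B15Prop1Carrier.orbit`, the variables `extSet`, the domain `domReg`, the chart `B16Sect1Backgrounds.expMul`):
the dictionary items **(c2)** (every value of the variables lies on the Λ-orbit of a chart point `exp(iB′)·Ṽ_k` with `B′`
supported off the tree `G₀`) and **(c1)** (the Λ-orbit of a chart point lies in the variables ∩ the domain) of
`B15Prop1CarrierOnFromModel.prop1Printed_lfVarOn_of_model` (p457808), reduced to located letters and otherwise PROVED.

statement-level skeleton of published theorems with citation tags; proofs where landed; nothing here is a claim about
the Yang–Mills mass gap

Cell pub-ymgap, HUMAN RULING D-0062 (Track A full width), seat `pub-ymgap-dag-n12-c` (R134 acceleration seat (a), strategy s1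
of DAG node N12 = [B15], *«INHABIT `B15.Prop1Printed`»*; generation g2, first product; successor of g0's seven modules
`B15Prop1ModelCarrier` … `B15Prop1KernelSchur`, trigger (t1) of `HOME/pub-ymgap-dag-n12-c/HANDOFF.md`: *«(c2)+(c1): the comb-gauge
chart on Λ-orbits as an `∃ B′` coverage theorem at print's objects»*).  PDFs held: `paper:balaban1989-cmp122-large-field-i`
(journal page = PDF page + 174), `paper:balaban1989-cmp122-large-field-ii` (journal page = PDF page + 354; pp. 357–359 = PDF
3–5, text layer re-read by this seat 2026-08-26).

THE PRINT.  [LF-II] p. 359, verbatim: *«We fix such an extension, and we consider the variational problem for the function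
V′↾_Λ → A(U_{k,Z}(V′V_k)), where V′ satisfies mild regularity conditions. Fixing the gauge G₀ for V′ we get a small
configuration, and we can write V′ = exp iB′.»*  p. 358: *«… that G₀ determines the axial gauge in Λ … The inequality is also
much more general, holding for general domains Λ, and graphs G₀ fixing a gauge in Λ, but with different constants.»*  [IV]
p. 194: *«The function is invariant with respect to the group of all gauge transformations defined on Λ, hence it is natural to
consider it on orbits of this group.»*  [IV] p. 196 (the tree gauge): *«We fix the gauge putting the bond variables equal to 1
for bonds belonging to the tree graph. We use all gauge degrees of freedom connected with points of P₁∖P₂, except one, so we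
add an external bond to the graph.»*

THE LOCATED CONTENT, in the tree's vocabulary (`S = Λ^{(k)}`, `Λb = bondsOf S` the variables' bonds, `Ṽ = Ṽ_k` the fixed
extension of the datum, `V` a value of the variables, `T = G₀` a bond set carrying pv26's fresh-endpoint order
`T4AxialGaugeFixing.TreeOrder T v r` WITH ALL FRESH ENDS IN `S` — a rooted forest whose roots lie OUTSIDE `S`, print's tree on
`Λ` *«plus an external bond»*; `|T| = |S|` fixes the Λ-gauge completely):
(G)  GAUGE FIXING (PROVED, §1–§2): there is `u` with `u = 1` off `S` (`IsGaugeOn S u`) and `V^u = Ṽ` on `T`; since `u = 1` off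
     `S` also `V^u = V = Ṽ` off `Λb`.  So `V′ := V^u·Ṽ⁻¹` (bondwise) is `1` on `T ∪ Λbᶜ`.
(R)  *«we get a small configuration»* (PROVED identity, §3): for `b ∈ Λb ∖ T` and ANY chain of bonds based at sites outside
     `S`, passing through `b` once and otherwise through `T ∪ Λbᶜ`, `|V′(b) − 1| ≤ |V(ℓ) − 1| + |Ṽ(ℓ) − 1|` where `V(ℓ)`,
     `Ṽ(ℓ)` are the ordered holonomies of the chain (`T4TreeGaugeTransform.chainHol`): gauge covariance of the holonomy
     (`chainHol_gaugeAct`, `u = 1` at the base points) and agreement of `V^u`, `Ṽ` along the rest of the chain.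
(L)  THE LOOP LETTER (displayed, NOT discharged): for the printed `G₀` every such `b` HAS a chain as in (R) with
     `|V(ℓ) − 1| + |Ṽ(ℓ) − 1| < δc` — the Stokes-type bound *«|V(Γ) − 1| ≦ Σ_{p ⊂ surface} |V(∂p) − 1|»* along the comb contours of
     length `O(d·100M)` for configurations in the domain *«|∂V − 1| < a₁ on Z»* and regular extensions ([IV] p. 193 *«|∂Ṽ_k − 1|
     < O(1)M²ε»*); its single-box mechanism is pv26's `T4AxialGaugeSmallField.dist1_hol_ladder_le_local`.
(X)  THE CHART LETTERS (displayed): `exp i((1/i) log g) = g` and `|(1/i) log g| ≤ C_ℓ|g − 1|` for `|g − 1| < δc` — the abstract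
     `ExpChart` of `B16Sect1Backgrounds` records only `exp i0 = 1`, `(1/i) log 1 = 0` (DIVERGENCE F4: no matrix model).
(c2) (§4, PROVED from (G)+(R) and the letters (L), (X)): `V ∈ orbit S (expMul ch B′ Ṽ)` with `B′` SUPPORTED ON `Λb ∖ T` (*«B′
     satisfying the gauge condition B′↾_{G₀} = 0»*, p. 359), every chart factor `exp(iB′(b))` within `δc` of `1`, and
     `‖B′(b)‖ ≤ C_ℓ·δc`.
(c1) (§5, PROVED from g0's one-plaquette bound `B15Prop1ChartDeviation.dist1_plaqHol_expMul_le_of_forall`): for `B′` supported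
     on `Λb` with chart factors within `t` of `1` and `Ṽ` in the domain with margin `4t`, `orbit S (expMul ch B′ Ṽ) ⊆ extSet Λb
     V_k ∩ domReg Z k a₁`.

WHAT THIS FILE PROVES (theorems only; Mathlib + the two imports; no `sorry`, no definition, no `… : Prop` fact, no `instance`;
axioms standard).  §1 `exists_gaugeTransf_freshSupport` — THE ROOTED TREE GAUGE: along a fresh-endpoint order every
configuration is carried to every prescription on `T` by a transformation equal to `1` OFF THE FRESH ENDS (pv26's
`T4TreeGaugeTransform.exists_gaugeTransf` gives `1` off the sites touched by `T`; the external bond of p. 196 touches its outer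
end, which must stay un-gauged — hence this sharpening, same peeling induction); `exists_isGaugeOn_fix`.  §2
`gaugeAct_apply_of_not_mem_bondsOf`, `exists_isGaugeOn_agree` ((G)).  §3 (private chain algebra `chainStep_congr`,
`chainHol_inv_mul_eq_of_agree`, `chainStep_mul_inv_eq_conj`), `dist1_chainStep_ratio_le`, `dist1_ratio_le_of_chain`, `dist1_gaugeAct_ratio_le` ((R)).  §4
`exists_vecField_expMul_eq` (the chart coordinate `B′` of `V^u` relative to `Ṽ`, from (X)), `exists_mem_orbit_expMul` ((c2) from
(G), (R), (L), (X)), `exists_mem_orbit_expMul_norm` (with `‖B′(b)‖ ≤ C_ℓ·δc`).  §5 `IsSupportedOn.mono`, `expMul_mem_extSet`,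
`expMul_mem_domReg`, `orbit_expMul_subset` ((c1)), `orbit_expMul_subset_of_sdiff` ((c1) for the chart point of (c2)).  §6 PRINT'S
`G₀` INHABITS THE HYPOTHESES: `treeOrder_comb_ext` — the axial comb of a non-wrapping parallelepiped `[lo, hi]` on the torus (pv26's
`T4AxialGaugeFixing.combBonds`, *«G₀ determines the axial gauge in Λ»*) plus the external bond `⟨lo − e_{μ₀}, lo⟩` carries a
fresh-endpoint order (fresh end = target, rank = depth below the outer corner); `tgt_comb_ext_mem` (all fresh ends are lattice
points of `[lo, hi]`); `exists_isGaugeOn_fix_comb_ext` (§1 at print's tree: the `G₀`-gauge by a transformation defined on any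
`S ⊇ Λ`-points).

HONEST SCOPE.  (i) The letters (L) and (X) are displayed, not discharged: (L) is the geometric estimate of the printed tree
(`B15TreeGraph196` ∕ `B15TreeGaugeFixing196.treeOrder_tree` type the tree and its peeling order; the holonomy bound along its
contours on the torus carrier is the located remainder — for ONE box in axial gauge it is pv26's
`T4AxialGaugeSmallField.dist1_gaugeAct_axialGauge_le_uniform`); (X) holds for the matrix exponential near `1` and is NOT a
property of the abstract chart.  (ii) The tree `T` is ANY bond set with a fresh-endpoint order whose fresh ends lie in `S`
(print's instance, §6: the comb of `Λ` plus one external bond; p. 358 *«much more general … graphs G₀ fixing a gauge in Λ»*);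
that `|T| = |S|` (complete gauge fixing, needed for the UNIQUENESS half of (c2)'s use) is not used here and not proved here (for
the comb + external bond it is `|Λ| − 1 + 1`; r12's `B15TreeGraph196.card_tree` is the graph-side count).  (iii) Nothing of
Proposition 1 is asserted; this file discharges the SHAPE of (c1)/(c2) at objects modulo (L)/(X); the packaging of
`{B′ : supported on Λb ∖ T}` as the normed space `E i` of `prop1Printed_lfVarOn_of_model` (an `ℓ²`/sup equivalence on a finite
bond set) is bookkeeping left to the pin.  Count-neutral; NOT a discharge of N12; NOT summit progress.
-/

noncomputable section

open Set

namespace Literature.MathematicalPhysics.QuantumFieldTheory.Balaban1983to89.B15Prop1GaugeFixing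

open B15DeterminingSets GaugeField B16Sect1Backgrounds B15Prop1Carrier B8Eq17ClassAkV1
open T4AxialGaugeFixing (siteTransf siteTransf_of_ne gaugeAct_siteTransf_apply TreeOrder)
open T4TreeGaugeFixing (Joins)
open T4TreeGaugeTransform (gaugeAct_mul chainStep chainHol chainHol_succ chainHol_gaugeAct chainHol_congr)

variable {P : Params}

/-! ## §1 The rooted tree gauge: prescribing `T` by a transformation equal to `1` off the fresh ends -/

section RootedTreeGauge

variable {j : ℕ} {G : Type*} [GaugeGroup G]

/-- **THE ROOTED TREE GAUGE.**  Along a fresh-endpoint order `TreeOrder T v r` (pv26), for every configuration `U` and every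
prescription `U₀` there is a gauge transformation `u` with `U^u = U₀` on `T` which equals `1` at every site that is NOT A FRESH
END `v b`, `b ∈ T` — in particular at the roots (the outer end of the *«external bond»* of p. 196 stays un-gauged).  Same
peeling induction as `T4TreeGaugeTransform.exists_isTreeGauge_of_treeOrder` (peel the bond of maximal fresh-end rank and
correct at its fresh end), with the sharper support bookkeeping. [cite: Balaban1989LargeFieldI, p.196 («We fix the gauge putting
the bond variables equal to 1 for bonds belonging to the tree graph. We use all gauge degrees of freedom connected with points of
P₁∖P₂, except one, so we add an external bond to the graph»)] -/
theorem exists_gaugeTransf_freshSupport [DecidableEq (PBond P j)] {T : Finset (PBond P j)} {v : PBond P j → Site P j}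
    {r : Site P j → ℕ} (hT : TreeOrder T v r) (U U₀ : GaugeField P j G) :
    ∃ u : GaugeTransf P j G, (∀ b ∈ T, gaugeAct u U b = U₀ b) ∧ ∀ y, (∀ b ∈ T, v b ≠ y) → u y = 1 := by
  suffices H : ∀ (n : ℕ) (T : Finset (PBond P j)), T.card = n → TreeOrder T v r →
      ∃ u : GaugeTransf P j G, (∀ b ∈ T, gaugeAct u U b = U₀ b) ∧ ∀ y, (∀ b ∈ T, v b ≠ y) → u y = 1 from H _ T rfl hT
  intro n
  induction n with
  | zero =>
    intro T hc _
    rw [Finset.card_eq_zero] at hc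
    subst hc
    exact ⟨fun _ => 1, fun b hb => absurd hb (Finset.notMem_empty b), fun _ _ => rfl⟩
  | succ n ih =>
    intro T hc hT
    have hne : T.Nonempty := by rw [← Finset.card_pos, hc]; exact Nat.succ_pos n
    obtain ⟨b₀, hb₀, hmax⟩ := Finset.exists_max_image T (fun b => r (v b)) hne
    have hfresh := hT.fresh_of_max hb₀ hmax
    have hc' : (T.erase b₀).card = n := by rw [Finset.card_erase_of_mem hb₀, hc]; rfl
    obtain ⟨u', hfix', hsupp'⟩ := ih _ hc' (hT.mono (Finset.erase_subset b₀ T))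
    -- correct at the fresh end `x = v b₀` by the one-site transformation with the peeling parameter `g`
    have hx := hT.endpoint b₀ hb₀
    have hne₀ := hT.ne b₀ hb₀
    refine ⟨fun y => siteTransf (v b₀)
        (if b₀.src = v b₀ then U₀ b₀ * (gaugeAct u' U b₀)⁻¹ else (U₀ b₀)⁻¹ * gaugeAct u' U b₀) y * u' y, ?_, ?_⟩
    · intro b hb
      rw [gaugeAct_mul, gaugeAct_siteTransf_apply]
      by_cases hbb : b = b₀
      · subst hbb
        rcases hx with hx | hx
        · have hs : b.src = v b := hx.symm
          have ht : b.tgt ≠ v b := fun h' => hne₀ (hs.trans h'.symm)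
          simp only [hs, ht, if_true, if_false, mul_one, inv_mul_cancel_right]
        · have ht : b.tgt = v b := hx.symm
          have hs : b.src ≠ v b := fun h' => hne₀ (h'.trans ht.symm)
          simp only [hs, ht, if_true, if_false, one_mul, mul_inv_rev, inv_inv, mul_inv_cancel_left]
      · have hb' : b ∈ T.erase b₀ := Finset.mem_erase.2 ⟨hbb, hb⟩
        obtain ⟨hs, ht⟩ := hfresh b hb'
        simp only [hs, ht, if_false, one_mul, mul_one]
        exact hfix' b hb'
    · intro y hy
      have hyx : y ≠ v b₀ := fun h => hy b₀ hb₀ h.symm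
      have h1 : u' y = 1 := hsupp' y fun b hb => hy b (Finset.mem_of_mem_erase hb)
      show siteTransf (v b₀) _ y * u' y = 1
      rw [siteTransf_of_ne hyx, h1, mul_one]

/-- **Rooted tree gauge, Λ-form.**  If every fresh end of the order lies in the site set `S` (*«gauge degrees of freedom connected
with points of»* `Λ`), the transformation is DEFINED ON `S` in the sense of `B15Prop1Carrier.IsGaugeOn` (`= 1` off `S`).
[cite: Balaban1989LargeFieldI, (1.77) p.194, p.196] -/
theorem exists_isGaugeOn_fix [DecidableEq (PBond P j)] {T : Finset (PBond P j)} {v : PBond P j → Site P j}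
    {r : Site P j → ℕ} (hT : TreeOrder T v r) {S : Set (Site P j)} (hv : ∀ b ∈ T, v b ∈ S) (U U₀ : GaugeField P j G) :
    ∃ u : GaugeTransf P j G, IsGaugeOn S u ∧ ∀ b ∈ T, gaugeAct u U b = U₀ b := by
  obtain ⟨u, hfix, hsupp⟩ := exists_gaugeTransf_freshSupport hT U U₀
  exact ⟨u, fun y hy => hsupp y fun b hb h => hy (h ▸ hv b hb), hfix⟩

end RootedTreeGauge

/-! ## §2 The `G₀`-representative of a value of the variables, relative to the fixed extension `Vt_k` -/

section Representative

variable {j : ℕ} {G : Type*} [GaugeGroup G]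

/-- A transformation defined on `S` does not move the bond variables off the bonds meeting `S` (both endpoints carry `u = 1`;
`B15Eq177GaugeInvariance.gaugeAct_eq_of_not_mem` is the case `S = Λ^{(k)}`). [cite: Balaban1989LargeFieldI, (1.77) p.194] -/
theorem gaugeAct_apply_of_not_mem_bondsOf {S : Set (Site P j)} {u : GaugeTransf P j G} (hu : IsGaugeOn S u)
    (V : GaugeField P j G) {b : PBond P j} (hb : b ∉ bondsOf S) : gaugeAct u V b = V b := by
  have hs : b.src ∉ S := fun h => hb (Or.inl h)
  have ht : b.tgt ∉ S := fun h => hb (Or.inr h)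
  simp [gaugeAct, hu _ hs, hu _ ht]

/-- **(G) THE `G₀`-REPRESENTATIVE.**  For a tree order on `T` with fresh ends in `S` and a value `V` of the variables at the fixed
extension `Ṽ` (`V = Ṽ` off the bonds meeting `S`), there is `u` defined on `S` with `V^u = Ṽ` ON `T` AND OFF `bondsOf S` — the
representative of the Λ-orbit of `V` in the gauge `G₀` (*«Fixing the gauge G₀ for V′»*, `V′ = V^u·Ṽ⁻¹ = 1` on `G₀`).
[cite: Balaban1989LargeFieldII, p.359; Balaban1989LargeFieldI, p.196] -/
theorem exists_isGaugeOn_agree [DecidableEq (PBond P j)] {T : Finset (PBond P j)} {v : PBond P j → Site P j}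
    {r : Site P j → ℕ} (hT : TreeOrder T v r) {S : Set (Site P j)} (hv : ∀ b ∈ T, v b ∈ S) {Vt V : GaugeField P j G}
    (hV : V ∈ extSet (bondsOf S) Vt) :
    ∃ u : GaugeTransf P j G, IsGaugeOn S u ∧ ∀ b, (b ∈ T ∨ b ∉ bondsOf S) → gaugeAct u V b = Vt b := by
  obtain ⟨u, hu, hfix⟩ := exists_isGaugeOn_fix hT hv V Vt
  refine ⟨u, hu, fun b hb => ?_⟩
  by_cases hbT : b ∈ T
  · exact hfix b hbT
  · have hb' : b ∉ bondsOf S := hb.resolve_left hbT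
    rw [gaugeAct_apply_of_not_mem_bondsOf hu V hb']
    exact hV b hb'

end Representative

/-! ## §3 (R) *«we get a small configuration»*: the ratio `V^u(b)·Vt(b)⁻¹` through holonomies of chains -/

section Ratio

variable {j : ℕ} {G : Type*} [GaugeGroup G] (s : ℕ → Site P j) (c : ℕ → PBond P j)

/-- One transport step depends on the bond variable `U(c m)` only. [folklore] -/
private theorem chainStep_congr {W W' : GaugeField P j G} {m : ℕ} (h : W (c m) = W' (c m)) :
    chainStep s c W m = chainStep s c W' m := by
  unfold chainStep
  rw [h]

/-- Two configurations agreeing along the steps `m₁ ≤ m < n` of a chain have the same transport FROM `s m₁` TO `s n`: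
`hol_{m₁}(W)⁻¹·hol_n(W) = hol_{m₁}(W′)⁻¹·hol_n(W′)`. [folklore] -/
private theorem chainHol_inv_mul_eq_of_agree {W W' : GaugeField P j G} {m₁ n : ℕ} (hle : m₁ ≤ n)
    (h : ∀ m, m₁ ≤ m → m < n → W (c m) = W' (c m)) :
    (chainHol s c W m₁)⁻¹ * chainHol s c W n = (chainHol s c W' m₁)⁻¹ * chainHol s c W' n := by
  induction n, hle using Nat.le_induction with
  | base => simp
  | succ n hmn ih =>
    rw [chainHol_succ, chainHol_succ, ← mul_assoc, ← mul_assoc, ih fun m h1 h2 => h m h1 (Nat.lt_succ_of_lt h2),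
      chainStep_congr s c (h n hmn n.lt_succ_self)]

/-- **The ratio of one step through the whole chain.**  If `W`, `W′` agree along a chain of `n` steps except possibly at the step
`m₀ < n`, then `step_{m₀}(W)·step_{m₀}(W′)⁻¹ = A⁻¹·(hol_n(W)·hol_n(W′)⁻¹)·A` with `A = hol_{m₀}(W′)` — the discrepancy of the
one bond variable is CONJUGATE to the discrepancy of the two holonomies. [folklore] -/
private theorem chainStep_mul_inv_eq_conj {W W' : GaugeField P j G} {m₀ n : ℕ} (hm₀ : m₀ < n)
    (hagree : ∀ m < n, m ≠ m₀ → W (c m) = W' (c m)) :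
    chainStep s c W m₀ * (chainStep s c W' m₀)⁻¹ =
      (chainHol s c W' m₀)⁻¹ * (chainHol s c W n * (chainHol s c W' n)⁻¹) * chainHol s c W' m₀ := by
  have hA : chainHol s c W m₀ = chainHol s c W' m₀ :=
    chainHol_congr s c fun m hm => hagree m (hm.trans hm₀) (ne_of_lt hm)
  have hX := chainHol_inv_mul_eq_of_agree s c (W := W) (W' := W') (Nat.succ_le_of_lt hm₀)
    fun m h1 h2 => hagree m h2 (by omega)
  have hn : chainHol s c W n = chainHol s c W (m₀ + 1) * ((chainHol s c W' (m₀ + 1))⁻¹ * chainHol s c W' n) := by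
    rw [← hX, mul_inv_cancel_left]
  rw [hn, chainHol_succ, chainHol_succ, hA]
  group

/-- Hence `|step_{m₀}(W)·step_{m₀}(W′)⁻¹ − 1| ≤ |hol_n(W) − 1| + |hol_n(W′) − 1|` (B7 (19): `|hgh⁻¹ − 1| = |g − 1|`,
`|gh − 1| ≤ |g − 1| + |h − 1|`, `|g⁻¹ − 1| = |g − 1|`). [cite: Balaban1985Averaging, (19) p.21] -/
theorem dist1_chainStep_ratio_le {W W' : GaugeField P j G} {m₀ n : ℕ} (hm₀ : m₀ < n)
    (hagree : ∀ m < n, m ≠ m₀ → W (c m) = W' (c m)) :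
    dist1 (chainStep s c W m₀ * (chainStep s c W' m₀)⁻¹) ≤ dist1 (chainHol s c W n) + dist1 (chainHol s c W' n) := by
  rw [chainStep_mul_inv_eq_conj s c hm₀ hagree]
  have hconj : dist1 ((chainHol s c W' m₀)⁻¹ * (chainHol s c W n * (chainHol s c W' n)⁻¹) * chainHol s c W' m₀) =
      dist1 (chainHol s c W n * (chainHol s c W' n)⁻¹) := by
    have e : (chainHol s c W' m₀)⁻¹ * (chainHol s c W n * (chainHol s c W' n)⁻¹) * chainHol s c W' m₀ =
        (chainHol s c W' m₀)⁻¹ * (chainHol s c W n * (chainHol s c W' n)⁻¹) * ((chainHol s c W' m₀)⁻¹)⁻¹ := by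
      rw [inv_inv]
    rw [e]
    exact GaugeGroup.dist1_conj _ _
  rw [hconj]
  calc dist1 (chainHol s c W n * (chainHol s c W' n)⁻¹)
      ≤ dist1 (chainHol s c W n) + dist1 ((chainHol s c W' n)⁻¹) := GaugeGroup.dist1_mul_le _ _
    _ = dist1 (chainHol s c W n) + dist1 (chainHol s c W' n) := by rw [GaugeGroup.dist1_inv]

/-- **(R) for the bond variable.**  If the `m₀`-th bond of the chain is `b` (joining `s m₀` to `s (m₀+1)`, either orientation)
and `W`, `W′` agree along the other steps, then `|W(b)·W′(b)⁻¹ − 1| ≤ |hol_n(W) − 1| + |hol_n(W′) − 1|`.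
[cite: Balaban1989LargeFieldII, p.359 («we get a small configuration»)] -/
theorem dist1_ratio_le_of_chain {W W' : GaugeField P j G} {b : PBond P j} {m₀ n : ℕ} (hm₀ : m₀ < n) (hb : c m₀ = b)
    (hagree : ∀ m < n, m ≠ m₀ → W (c m) = W' (c m)) :
    dist1 (W b * (W' b)⁻¹) ≤ dist1 (chainHol s c W n) + dist1 (chainHol s c W' n) := by
  subst hb
  have h := dist1_chainStep_ratio_le s c hm₀ hagree
  by_cases hsrc : (c m₀).src = s m₀
  · simpa only [chainStep, hsrc, if_true] using h
  · simp only [chainStep, hsrc, if_false, inv_inv] at h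
    -- `|W(b)W′(b)⁻¹ − 1| = |W(b)⁻¹W′(b) − 1|` (inverse, then conjugation by `W b`)
    have h1 : dist1 (W (c m₀) * (W' (c m₀))⁻¹) = dist1 ((W (c m₀))⁻¹ * W' (c m₀)) := by
      rw [← GaugeGroup.dist1_inv, mul_inv_rev, inv_inv,
        show W' (c m₀) * (W (c m₀))⁻¹ = W (c m₀) * ((W (c m₀))⁻¹ * W' (c m₀)) * (W (c m₀))⁻¹ by group,
        GaugeGroup.dist1_conj]
    rw [h1]
    exact h

/-- **(R) for the `G₀`-representative.**  Let `u` be `1` at the base points `s 0`, `s n` of a chain whose `m₀`-th bond is `b` and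
along whose other bonds `V^u = Ṽ`.  Then `|V^u(b)·Ṽ(b)⁻¹ − 1| ≤ |V(ℓ) − 1| + |Ṽ(ℓ) − 1|` with the holonomies of the ORIGINAL
configurations — gauge covariance of the transport, `T4TreeGaugeTransform.chainHol_gaugeAct`.  This is *«Fixing the gauge G₀ for
V′ we get a small configuration»* reduced to the smallness of loop variables. [cite: Balaban1989LargeFieldII, p.359] -/
theorem dist1_gaugeAct_ratio_le {u : GaugeTransf P j G} {V Vt : GaugeField P j G} {b : PBond P j} {m₀ n : ℕ}
    (hjoins : ∀ m < n, Joins (c m) (s m) (s (m + 1))) (hu0 : u (s 0) = 1) (hun : u (s n) = 1) (hm₀ : m₀ < n)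
    (hb : c m₀ = b) (hagree : ∀ m < n, m ≠ m₀ → gaugeAct u V (c m) = Vt (c m)) :
    dist1 (gaugeAct u V b * (Vt b)⁻¹) ≤ dist1 (chainHol s c V n) + dist1 (chainHol s c Vt n) := by
  have h := dist1_ratio_le_of_chain s c hm₀ hb hagree
  rwa [chainHol_gaugeAct hjoins, hu0, hun, one_mul, inv_one, mul_one] at h

end Ratio

/-! ## §4 (c2) AT OBJECTS: the chart coordinate `B′` supported off `G₀`, and the orbit of the chart point -/

section Chart

variable {j : ℕ} {G : Type*} [GaugeGroup G] {𝔤 : Type*} [AddCommGroup 𝔤] [Module ℝ 𝔤] (ch : ExpChart G 𝔤)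

/-- **The chart coordinate of the representative** (*«we can write V′ = exp iB′»*).  If `W = Ṽ` on `T ∪ (bondsOf S)ᶜ` and
`|W(b)Ṽ(b)⁻¹ − 1| < δc` on the remaining bonds, then — under the local-inverse LETTER (X) `exp i((1/i) log g) = g` for
`|g − 1| < δc` — `W = exp(iB′)·Ṽ` with `B′(b) = (1/i) log (W(b)Ṽ(b)⁻¹)` on `bondsOf S ∖ T` and `B′ = 0` elsewhere: `B′` is
SUPPORTED OFF `G₀` (*«the gauge condition B′↾_{G₀} = 0»*) and every chart factor is within `δc` of `1`.
[cite: Balaban1989LargeFieldII, p.359] -/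
theorem exists_vecField_expMul_eq {δc : ℝ} (hδc : 0 < δc) (hlog : ∀ g : G, dist1 g < δc → ch.iexp (ch.ilog g) = g)
    {S : Set (Site P j)} {T : Finset (PBond P j)} {W Vt : GaugeField P j G}
    (hagree : ∀ b, (b ∈ T ∨ b ∉ bondsOf S) → W b = Vt b)
    (hsmall : ∀ b, b ∈ bondsOf S → b ∉ T → dist1 (W b * (Vt b)⁻¹) < δc) :
    ∃ B : VecField P j 𝔤, IsSupportedOn {b | b ∈ bondsOf S ∧ b ∉ T} B ∧
      (∀ b, B b = 0 ∨ B b = ch.ilog (W b * (Vt b)⁻¹)) ∧ (∀ b, dist1 (ch.iexp (B b)) < δc) ∧ expMul ch B Vt = W := by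
  classical
  refine ⟨fun b => if W b = Vt b then 0 else ch.ilog (W b * (Vt b)⁻¹), fun b hb => ?_, fun b => ?_, fun b => ?_, ?_⟩
  · have hb' : b ∈ T ∨ b ∉ bondsOf S := by
      by_contra h
      push Not at h
      exact hb ⟨h.2, h.1⟩
    simp [hagree b hb']
  · by_cases h : W b = Vt b
    · exact Or.inl (if_pos h)
    · exact Or.inr (if_neg h)
  · by_cases h : W b = Vt b
    · simp only [h, if_true, ch.iexp_zero, GaugeGroup.dist1_one]
      exact hδc
    · have hbS : b ∈ bondsOf S := by
        by_contra hbS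
        exact h (hagree b (Or.inr hbS))
      have hbT : b ∉ T := fun hbT => h (hagree b (Or.inl hbT))
      simp only [h, if_false, hlog _ (hsmall b hbS hbT)]
      exact hsmall b hbS hbT
  · funext b
    simp only [expMul]
    by_cases h : W b = Vt b
    · simp [h, ch.iexp_zero]
    · have hbS : b ∈ bondsOf S := by
        by_contra hbS
        exact h (hagree b (Or.inr hbS))
      have hbT : b ∉ T := fun hbT => h (hagree b (Or.inl hbT))
      simp only [h, if_false, hlog _ (hsmall b hbS hbT), inv_mul_cancel_right]

/-- **(c2) AT PRINT'S OBJECTS.**  Let `T` carry a fresh-endpoint order with fresh ends in `S` (the tree `G₀` on `Λ^{(k)}` with its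
external bond), let `V` be a value of the variables at the fixed extension `Ṽ` (`V ∈ extSet (bondsOf S) Ṽ`), and assume the
letters: (L) every bond `b` of `bondsOf S ∖ T` lies ONCE on a chain based at sites outside `S`, otherwise running through
`T ∪ (bondsOf S)ᶜ`, along which `|V(ℓ) − 1| + |Ṽ(ℓ) − 1| < δc`; (X) `exp i((1/i) log g) = g` for `|g − 1| < δc`.  Then `V` lies
on the Λ-orbit of a chart point `exp(iB′)·Ṽ` with `B′` supported on `bondsOf S ∖ T` and all chart factors within `δc` of `1`:
*«Fixing the gauge G₀ for V′ we get a small configuration, and we can write V′ = exp iB′»*.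
[cite: Balaban1989LargeFieldII, p.359; Balaban1989LargeFieldI, (1.77) p.194, p.196] -/
theorem exists_mem_orbit_expMul [DecidableEq (PBond P j)] {T : Finset (PBond P j)} {v : PBond P j → Site P j}
    {r : Site P j → ℕ} (hT : TreeOrder T v r) {S : Set (Site P j)} (hv : ∀ b ∈ T, v b ∈ S) {Vt V : GaugeField P j G}
    (hV : V ∈ extSet (bondsOf S) Vt) {δc : ℝ} (hδc : 0 < δc)
    (hlog : ∀ g : G, dist1 g < δc → ch.iexp (ch.ilog g) = g)
    (hloop : ∀ b, b ∈ bondsOf S → b ∉ T →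
      ∃ (s : ℕ → Site P j) (c : ℕ → PBond P j) (n m₀ : ℕ), m₀ < n ∧ c m₀ = b ∧
        (∀ m < n, Joins (c m) (s m) (s (m + 1))) ∧ s 0 ∉ S ∧ s n ∉ S ∧
        (∀ m < n, m ≠ m₀ → c m ∈ T ∨ c m ∉ bondsOf S) ∧
        dist1 (chainHol s c V n) + dist1 (chainHol s c Vt n) < δc) :
    ∃ B : VecField P j 𝔤, IsSupportedOn {b | b ∈ bondsOf S ∧ b ∉ T} B ∧ (∀ b, dist1 (ch.iexp (B b)) < δc) ∧
      V ∈ orbit S (expMul ch B Vt) := by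
  obtain ⟨u, hu, hagree⟩ := exists_isGaugeOn_agree hT hv hV
  have hsmall : ∀ b, b ∈ bondsOf S → b ∉ T → dist1 (gaugeAct u V b * (Vt b)⁻¹) < δc := by
    intro b hbS hbT
    obtain ⟨s, c, n, m₀, hm₀, hb, hjoins, hs0, hsn, hrest, hδ⟩ := hloop b hbS hbT
    exact (dist1_gaugeAct_ratio_le s c hjoins (hu _ hs0) (hu _ hsn) hm₀ hb
      fun m hm hne => hagree _ (hrest m hm hne)).trans_lt hδ
  obtain ⟨B, hBsupp, -, hBsmall, hBeq⟩ := exists_vecField_expMul_eq ch hδc hlog hagree hsmall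
  refine ⟨B, hBsupp, hBsmall, ?_⟩
  rw [hBeq]
  exact mem_orbit_comm.1 (gaugeAct_mem_orbit hu V)

end Chart

section ChartNorm

variable {j : ℕ} {G : Type*} [GaugeGroup G] {𝔤 : Type*} [NormedAddCommGroup 𝔤] [NormedSpace ℝ 𝔤] (ch : ExpChart G 𝔤)

/-- **(c2) with the size of `B′`.**  Under the second chart LETTER (X) `‖(1/i) log g‖ ≤ C_ℓ·|g − 1|` for `|g − 1| < δc` (matrix
logarithm near `1`), the coordinate of `exists_mem_orbit_expMul` has `‖B′(b)‖ ≤ C_ℓ·δc` on every bond — *«a small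
configuration … B′ … small»*; with `δc = O(M²)·(a₁ + ε)` from (L) this is the printed smallness of `B′`.
[cite: Balaban1989LargeFieldII, p.359; Balaban1989LargeFieldI, Prop. 1 p.194] -/
theorem exists_mem_orbit_expMul_norm [DecidableEq (PBond P j)] {T : Finset (PBond P j)} {v : PBond P j → Site P j}
    {r : Site P j → ℕ} (hT : TreeOrder T v r) {S : Set (Site P j)} (hv : ∀ b ∈ T, v b ∈ S) {Vt V : GaugeField P j G}
    (hV : V ∈ extSet (bondsOf S) Vt) {δc Cℓ : ℝ} (hδc : 0 < δc) (hCℓ : 0 ≤ Cℓ)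
    (hlog : ∀ g : G, dist1 g < δc → ch.iexp (ch.ilog g) = g)
    (hlip : ∀ g : G, dist1 g < δc → ‖ch.ilog g‖ ≤ Cℓ * dist1 g)
    (hloop : ∀ b, b ∈ bondsOf S → b ∉ T →
      ∃ (s : ℕ → Site P j) (c : ℕ → PBond P j) (n m₀ : ℕ), m₀ < n ∧ c m₀ = b ∧
        (∀ m < n, Joins (c m) (s m) (s (m + 1))) ∧ s 0 ∉ S ∧ s n ∉ S ∧
        (∀ m < n, m ≠ m₀ → c m ∈ T ∨ c m ∉ bondsOf S) ∧
        dist1 (chainHol s c V n) + dist1 (chainHol s c Vt n) < δc) :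
    ∃ B : VecField P j 𝔤, IsSupportedOn {b | b ∈ bondsOf S ∧ b ∉ T} B ∧ (∀ b, dist1 (ch.iexp (B b)) < δc) ∧
      (∀ b, ‖B b‖ ≤ Cℓ * δc) ∧ V ∈ orbit S (expMul ch B Vt) := by
  obtain ⟨u, hu, hagree⟩ := exists_isGaugeOn_agree hT hv hV
  have hsmall : ∀ b, b ∈ bondsOf S → b ∉ T → dist1 (gaugeAct u V b * (Vt b)⁻¹) < δc := by
    intro b hbS hbT
    obtain ⟨s, c, n, m₀, hm₀, hb, hjoins, hs0, hsn, hrest, hδ⟩ := hloop b hbS hbT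
    exact (dist1_gaugeAct_ratio_le s c hjoins (hu _ hs0) (hu _ hsn) hm₀ hb
      fun m hm hne => hagree _ (hrest m hm hne)).trans_lt hδ
  obtain ⟨B, hBsupp, hBval, hBsmall, hBeq⟩ := exists_vecField_expMul_eq ch hδc hlog hagree hsmall
  refine ⟨B, hBsupp, hBsmall, fun b => ?_, ?_⟩
  · rcases hBval b with h | h
    · rw [h, norm_zero]; positivity
    · have hb : ¬ (b ∈ T ∨ b ∉ bondsOf S) → dist1 (gaugeAct u V b * (Vt b)⁻¹) < δc := fun hn => by
        push Not at hn
        exact hsmall b hn.2 hn.1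
      by_cases hcase : b ∈ T ∨ b ∉ bondsOf S
      · -- on `T ∪ (bondsOf S)ᶜ` the ratio is `1`, so `B b = (1/i) log 1 = 0`
        rw [h, hagree b hcase, mul_inv_cancel, ch.ilog_one, norm_zero]
        positivity
      · have hd := hb hcase
        rw [h]
        calc ‖ch.ilog (gaugeAct u V b * (Vt b)⁻¹)‖ ≤ Cℓ * dist1 (gaugeAct u V b * (Vt b)⁻¹) := hlip _ hd
          _ ≤ Cℓ * δc := mul_le_mul_of_nonneg_left hd.le hCℓ
  · rw [hBeq]
    exact mem_orbit_comm.1 (gaugeAct_mem_orbit hu V)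

end ChartNorm

/-! ## §5 (c1) AT OBJECTS: the Λ-orbit of a chart point lies in the variables ∩ the domain -/

section Domain

variable {k : ℕ} {G : Type*} [GaugeGroup G] {𝔤 : Type*} [AddCommGroup 𝔤] [Module ℝ 𝔤] (ch : ExpChart G 𝔤)

omit [GaugeGroup G] [Module ℝ 𝔤] in
/-- Support monotonicity. [cite: Balaban1989LargeFieldII, (1.12) p.359] -/
theorem IsSupportedOn.mono {Λb Λb' : Set (PBond P k)} (h : Λb ⊆ Λb') {A : VecField P k 𝔤} (hA : IsSupportedOn Λb A) :
    IsSupportedOn Λb' A := fun b hb => hA b fun hb' => hb (h hb')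

/-- A chart point `exp(iB′)·V` with `B′` supported on `Λb` is a value of the variables at `V` (it moves the bond variables on
`Λb` only; the `s = 1` case of the carrier's `expMul_smul_mem_extSet`). [cite: Balaban1989LargeFieldI, (1.77) p.194] -/
theorem expMul_mem_extSet {Λb : Set (PBond P k)} {A : VecField P k 𝔤} (hA : IsSupportedOn Λb A) {Vk V : GaugeField P k G}
    (hV : V ∈ extSet Λb Vk) : expMul ch A V ∈ extSet Λb Vk := by
  simpa only [one_smul] using expMul_smul_mem_extSet ch hA hV (1 : ℝ)

/-- *«V′ satisfies mild regularity conditions»*: a chart point whose factors are within `t` of `1` over an extension lying in the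
example domain WITH MARGIN `4t` lies in the domain `domReg Z k a₁` (*«|∂V − 1| < a₁ on Z»*), by g0's one-plaquette bound
`B15Prop1ChartDeviation.dist1_plaqHol_expMul_le_of_forall`. [cite: Balaban1989LargeFieldI, (1.77) p.194; Balaban1989LargeFieldII, p.359] -/
theorem expMul_mem_domReg {Z : Set (Site P 0)} {a₁ t : ℝ} {A : VecField P k 𝔤} {Vt : GaugeField P k G}
    (ht : ∀ b : PBond P k, dist1 (ch.iexp (A b)) ≤ t)
    (hdom : ∀ p ∈ plaqsInside (pts k Z), dist1 (plaqHol Vt p) + 4 * t < a₁) :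
    expMul ch A Vt ∈ domReg Z k a₁ := fun p hp =>
  (B15Prop1ChartDeviation.dist1_plaqHol_expMul_le_of_forall ch A Vt p ht).trans_lt (hdom p hp)

/-- **(c1) AT PRINT'S OBJECTS.**  For `B′` supported on the bonds meeting `Λ^{(k)}`, chart factors within `t` of `1`, and a fixed
extension `Ṽ` of the datum `V_k` lying in the example domain with margin `4t` on the plaquettes `p ⊂ Z^{(k)}`: the Λ-orbit of the
chart point `exp(iB′)·Ṽ` lies in the variables at `V_k` ∩ the domain — the hypothesis (c1) of
`B15Prop1CarrierOnFromModel.prop1Printed_lfVarOn_of_model` at `dom = domReg Z k a₁` (`InstOn.std`).  Gauge invariance of both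
sets: the carrier's `orbit_subset_extSet`, `orbit_subset_domReg`. [cite: Balaban1989LargeFieldI, (1.77) p.194; Balaban1989LargeFieldII, p.359] -/
theorem orbit_expMul_subset {Λ Z : Set (Site P 0)} {A : VecField P k 𝔤} (hA : IsSupportedOn (bondsOf (pts k Λ)) A)
    {Vk Vt : GaugeField P k G} (hVt : Vt ∈ extSet (bondsOf (pts k Λ)) Vk) {a₁ t : ℝ}
    (ht : ∀ b : PBond P k, dist1 (ch.iexp (A b)) ≤ t)
    (hdom : ∀ p ∈ plaqsInside (pts k Z), dist1 (plaqHol Vt p) + 4 * t < a₁) :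
    orbit (pts k Λ) (expMul ch A Vt) ⊆ extSet (bondsOf (pts k Λ)) Vk ∩ domReg Z k a₁ :=
  subset_inter (orbit_subset_extSet (expMul_mem_extSet ch hA hVt)) (orbit_subset_domReg (expMul_mem_domReg ch ht hdom))

/-- **(c1) for the chart point of (c2).**  The coordinate produced by `exists_mem_orbit_expMul` is supported on `bondsOf S ∖ T ⊆
bondsOf S` with factors within `δc` of `1`; so its orbit lies in the variables ∩ the domain as soon as the extension has margin
`4δc`. [cite: Balaban1989LargeFieldI, (1.77) p.194; Balaban1989LargeFieldII, p.359] -/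
theorem orbit_expMul_subset_of_sdiff {Λ Z : Set (Site P 0)} {T : Finset (PBond P k)} {A : VecField P k 𝔤}
    (hA : IsSupportedOn {b | b ∈ bondsOf (pts k Λ) ∧ b ∉ T} A) {Vk Vt : GaugeField P k G}
    (hVt : Vt ∈ extSet (bondsOf (pts k Λ)) Vk) {a₁ δc : ℝ} (hδ : ∀ b : PBond P k, dist1 (ch.iexp (A b)) < δc)
    (hdom : ∀ p ∈ plaqsInside (pts k Z), dist1 (plaqHol Vt p) + 4 * δc < a₁) :
    orbit (pts k Λ) (expMul ch A Vt) ⊆ extSet (bondsOf (pts k Λ)) Vk ∩ domReg Z k a₁ :=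
  orbit_expMul_subset ch (IsSupportedOn.mono (fun _ hb => hb.1) hA) hVt (fun b => (hδ b).le) hdom

end Domain

/-! ## §6 PRINT'S `G₀`: the axial comb of a parallelepiped plus the external bond — the hypotheses of §1–§4 inhabited -/

section CombExt

variable {j : ℕ}

open T4AxialGaugeFixing (combBonds mem_combBonds boxDepth boxDepth_castSite treeOrder_combBonds)
open T4AxialGaugeSmallField (castSite castSite_add_e castSite_injOn_box)
open B7Prop1Explicit (e e_apply)
open B8Lemma1NonAbelian (e_nonneg)

/-- The enlarged corner `lo − e_{μ₀}` lies below `lo`. [folklore] -/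
private theorem sub_e_le (lo : Fin P.d → ℤ) (μ₀ : Fin P.d) : lo - e μ₀ ≤ lo :=
  sub_le_self lo (e_nonneg μ₀)

/-- Non-wrapping of the enlarged box `[lo − e_{μ₀}, hi]` implies non-wrapping of `[lo, hi]`. [folklore] -/
private theorem hN_of_hN' {lo hi : Fin P.d → ℤ} {μ₀ : Fin P.d} (hN' : ∀ κ, hi κ - (lo - e μ₀) κ < P.sitesPerDir j) :
    ∀ κ, hi κ - lo κ < P.sitesPerDir j := fun κ => by
  have h := hN' κ
  have h0 : (lo - e μ₀) κ ≤ lo κ := sub_e_le lo μ₀ κ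
  omega

/-- The depth below the enlarged corner increases by one along a unit step inside the enlarged box. [folklore] -/
private theorem boxDepth_step {lo hi : Fin P.d → ℤ} {μ₀ : Fin P.d} (hN' : ∀ κ, hi κ - (lo - e μ₀) κ < P.sitesPerDir j)
    {x : Fin P.d → ℤ} {μ : Fin P.d} (hx : lo - e μ₀ ≤ x) (hxμ : x + e μ ≤ hi) :
    boxDepth (lo - e μ₀) hi (castSite x : Site P j) < boxDepth (lo - e μ₀) hi (castSite (x + e μ) : Site P j) := by
  have hx' : x ≤ hi := (le_add_of_nonneg_right (e_nonneg _)).trans hxμ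
  have hlo' : lo - e μ₀ ≤ x + e μ := hx.trans (le_add_of_nonneg_right (e_nonneg _))
  rw [boxDepth_castSite hN' hx hx', boxDepth_castSite hN' hlo' hxμ]
  have hD : 0 ≤ ∑ κ, (x κ - (lo - e μ₀) κ) := Finset.sum_nonneg fun κ _ => sub_nonneg.2 (hx κ)
  have hD' : ∑ κ, ((x + e μ) κ - (lo - e μ₀) κ) = ∑ κ, (x κ - (lo - e μ₀) κ) + 1 := by
    simp only [Pi.add_apply]
    rw [show ∑ κ, (x κ + e μ κ - (lo - e μ₀) κ) = ∑ κ, ((x κ - (lo - e μ₀) κ) + e μ κ) from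
      Finset.sum_congr rfl fun κ _ => by ring, Finset.sum_add_distrib, T4AxialGaugeFixing.sum_e_apply]
  rw [hD']
  exact (Int.toNat_lt_toNat (by linarith)).2 (by linarith)

/-- **PRINT'S TREE `G₀` CARRIES A FRESH-ENDPOINT ORDER.**  The axial comb of the non-wrapping parallelepiped `[lo, hi]`
(pv26's `T4AxialGaugeFixing.combBonds`, *«G₀ determines the axial gauge in Λ»*, [LF-II] p. 358) TOGETHER WITH THE EXTERNAL BOND
`⟨lo − e_{μ₀}, lo⟩` ([IV] p. 196 *«we add an external bond to the graph»*, print's *«[(a′₁ − 1/2, a′₂ + 1/2, …), (a′₁ + 1/2,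
a′₂ + 1/2, …)]»*, `μ₀` = the `x₁`-direction) is tree-like: fresh end = target, rank = depth below the outer corner `lo − e_{μ₀}`.
Non-wrapping is asked of the enlarged box `[lo − e_{μ₀}, hi]`. [cite: Balaban1989LargeFieldI, p.196; Balaban1989LargeFieldII, (1.8) p.358] -/
theorem treeOrder_comb_ext [DecidableEq (PBond P j)] {lo hi : Fin P.d → ℤ} (μ₀ : Fin P.d) (hlohi : lo ≤ hi)
    (hN' : ∀ κ, hi κ - (lo - e μ₀) κ < P.sitesPerDir j) :
    TreeOrder (insert (⟨castSite (lo - e μ₀), μ₀⟩ : PBond P j) (combBonds lo hi : Finset (PBond P j))) PBond.tgt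
      (boxDepth (lo - e μ₀) hi) := by
  classical
  have hN := hN_of_hN' hN'
  have hcomb := treeOrder_combBonds (j := j) hN
  have hext_tgt : (⟨castSite (lo - e μ₀), μ₀⟩ : PBond P j).tgt = castSite lo := by
    show (castSite (lo - e μ₀) : Site P j).shift μ₀ = castSite lo
    rw [← castSite_add_e, sub_add_cancel]
  refine ⟨fun _ _ => Or.inr rfl, fun b hb => ?_, fun b hb b' hb' h => ?_, fun b hb => ?_⟩
  · -- no loops
    rcases Finset.mem_insert.1 hb with rfl | hb
    · intro h
      rw [hext_tgt] at h
      have h1 := congr_fun (castSite_injOn_box hN' le_rfl ((sub_e_le lo μ₀).trans hlohi) (sub_e_le lo μ₀) hlohi h) μ₀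
      simp [e_apply] at h1
    · exact hcomb.ne b hb
  · -- fresh ends are distinct
    rcases Finset.mem_insert.1 hb with rfl | hb <;> rcases Finset.mem_insert.1 hb' with rfl | hb'
    · rfl
    · exfalso
      obtain ⟨x, hlo, hhi, hsrc, -⟩ := mem_combBonds.1 hb'
      rw [hext_tgt, PBond.tgt, hsrc, ← castSite_add_e] at h
      have hlo' : lo ≤ x + e b'.dir := hlo.trans (le_add_of_nonneg_right (e_nonneg _))
      have h1 := congr_fun (castSite_injOn_box hN le_rfl hlohi hlo' hhi h) b'.dir
      have h2 := hlo b'.dir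
      simp [e_apply] at h1
      linarith
    · exfalso
      obtain ⟨x, hlo, hhi, hsrc, -⟩ := mem_combBonds.1 hb
      rw [hext_tgt, PBond.tgt, hsrc, ← castSite_add_e] at h
      have hlo' : lo ≤ x + e b.dir := hlo.trans (le_add_of_nonneg_right (e_nonneg _))
      have h1 := congr_fun (castSite_injOn_box hN hlo' hhi le_rfl hlohi h) b.dir
      have h2 := hlo b.dir
      simp [e_apply] at h1
      linarith
    · exact hcomb.inj b hb b' hb' h
  · -- the rank increases towards the fresh end
    left
    rcases Finset.mem_insert.1 hb with rfl | hb
    · rw [hext_tgt]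
      have h := boxDepth_step (j := j) hN' (μ := μ₀) le_rfl (by rw [sub_add_cancel]; exact hlohi)
      rwa [sub_add_cancel] at h
    · obtain ⟨x, hlo, hhi, hsrc, -⟩ := mem_combBonds.1 hb
      rw [PBond.tgt, hsrc, ← castSite_add_e]
      exact boxDepth_step hN' ((sub_e_le lo μ₀).trans hlo) hhi

/-- Every fresh end (= target) of `G₀` is a lattice point of the parallelepiped `[lo, hi]` — *«gauge degrees of freedom connected
with points of»* `Λ`: the comb bonds end inside the box and the external bond ends at the corner `lo`.
[cite: Balaban1989LargeFieldI, p.196] -/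
theorem tgt_comb_ext_mem [DecidableEq (PBond P j)] {lo hi : Fin P.d → ℤ} (μ₀ : Fin P.d) (hlohi : lo ≤ hi) :
    ∀ b ∈ insert (⟨castSite (lo - e μ₀), μ₀⟩ : PBond P j) (combBonds lo hi : Finset (PBond P j)),
      b.tgt ∈ {y : Site P j | ∃ x : Fin P.d → ℤ, lo ≤ x ∧ x ≤ hi ∧ y = castSite x} := by
  classical
  intro b hb
  rcases Finset.mem_insert.1 hb with rfl | hb
  · refine ⟨lo, le_rfl, hlohi, ?_⟩
    show (castSite (lo - e μ₀) : Site P j).shift μ₀ = castSite lo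
    rw [← castSite_add_e, sub_add_cancel]
  · obtain ⟨x, hlo, hhi, hsrc, -⟩ := mem_combBonds.1 hb
    refine ⟨x + e b.dir, hlo.trans (le_add_of_nonneg_right (e_nonneg _)), hhi, ?_⟩
    rw [PBond.tgt, hsrc, ← castSite_add_e]

variable {G : Type*} [GaugeGroup G]

/-- **THE `G₀`-GAUGE OF PRINT EXISTS.**  For the parallelepiped `Λ = [lo, hi]` on the torus (non-wrapping with its external corner)
and ANY site set `S` containing its lattice points: every configuration is carried by a transformation DEFINED ON `S` to any
prescription on the comb and on the external bond — §1 at print's tree.  (With `U₀ = Ṽ_k` and `V` a value of the variables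
this is (G) of the header.) [cite: Balaban1989LargeFieldI, p.196; Balaban1989LargeFieldII, p.358–359] -/
theorem exists_isGaugeOn_fix_comb_ext [DecidableEq (PBond P j)] {lo hi : Fin P.d → ℤ} (μ₀ : Fin P.d) (hlohi : lo ≤ hi)
    (hN' : ∀ κ, hi κ - (lo - e μ₀) κ < P.sitesPerDir j) {S : Set (Site P j)}
    (hS : ∀ x : Fin P.d → ℤ, lo ≤ x → x ≤ hi → (castSite x : Site P j) ∈ S) (U U₀ : GaugeField P j G) :
    ∃ u : GaugeTransf P j G, IsGaugeOn S u ∧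
      ∀ b ∈ insert (⟨castSite (lo - e μ₀), μ₀⟩ : PBond P j) (combBonds lo hi : Finset (PBond P j)), gaugeAct u U b = U₀ b := by
  classical
  refine exists_isGaugeOn_fix (treeOrder_comb_ext μ₀ hlohi hN') (fun b hb => ?_) U U₀
  obtain ⟨x, hlo, hhi, hx⟩ := tgt_comb_ext_mem (j := j) μ₀ hlohi b hb
  rw [hx]
  exact hS x hlo hhi

end CombExt

end Literature.MathematicalPhysics.QuantumFieldTheory.Balaban1983to89.B15Prop1GaugeFixing

end
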